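import Mathlib
import Literature.Geometry.DiscreteGeometry.CrystallographicGroups
import Summits.AtomisticToContinuum.Crystallization.Theorems.IsometryAtomsMinimisingLawsCohesiveGroupStructureAux1

/-!
# Discontinuous groups of isometries of `ℝ³`, part 2: translation rank three and two

Helper file for stub `stub_groupStructure` (F) of line `purity_stacking` of the crux
`IsometryAtoms.MinimisingLawsCohesive` (stmt-AtomisticToContinuum-15777).

* If the translation vectors of a discontinuous `Γ ≤ Isom(ℝ³)` contain a basis `b` of `ℝ³` all of
  whose images under the linear parts of `Γ` lie in one finite set, then `Γ` has finitely many
  linear parts (a linear map is determined on a basis); hence (part 1) its finite subgroups have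
  bounded order. This applies when the translations have rank three (images of translation vectors
  are translation vectors of the same norm, a finite set by discontinuity), and when they have rank
  two (add the unit normal `n` of the translation plane, which every linear part maps to `±n`).
* Rank two: the finite group of heights `x ↦ ⟨g x, n⟩ = ±⟨x, n⟩ + σ_g` has a fixed height, i.e.
  `Γ` leaves a plane `{⟨x, n⟩ = h₀}` invariant.
-/

noncomputable section

open scoped RealInnerProductSpace
open Literature.Geometry.DiscreteGeometry.Crystallographic Module

namespace Summit.AtomisticToContinuum.Crystallization.Theorems.IsometryAtomsMinimisingLawsCohesive.GroupStructure

variable {Γ : Subgroup (EuclideanSpace ℝ (Fin 3) ≃ᵢ EuclideanSpace ℝ (Fin 3))}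

/-! ## Finitely many linear parts from a controlled basis -/

/-- If every linear part of `Γ` maps each vector of a basis `b` into a fixed finite set `S`, then
`Γ` has finitely many linear parts. -/
theorem finite_linParts_of_mapsTo_basis {ι : Type*} [Fintype ι] (b : Basis ι ℝ (EuclideanSpace ℝ (Fin 3)))
    {S : Set (EuclideanSpace ℝ (Fin 3))} (hS : S.Finite)
    (h : ∀ g ∈ Γ, ∀ i, g.toRealLinearIsometryEquiv (b i) ∈ S) :
    ((fun g : EuclideanSpace ℝ (Fin 3) ≃ᵢ EuclideanSpace ℝ (Fin 3) => g.toRealLinearIsometryEquiv) ''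
      (Γ : Set (EuclideanSpace ℝ (Fin 3) ≃ᵢ EuclideanSpace ℝ (Fin 3)))).Finite := by
  haveI : Finite S := hS.to_subtype
  let F : ((fun g : EuclideanSpace ℝ (Fin 3) ≃ᵢ EuclideanSpace ℝ (Fin 3) =>
      g.toRealLinearIsometryEquiv) '' (Γ : Set (EuclideanSpace ℝ (Fin 3) ≃ᵢ EuclideanSpace ℝ (Fin 3)))) →
      ι → S := fun L i => ⟨L.1 (b i), by
        obtain ⟨g, hg, hgL⟩ := L.2
        rw [← hgL]
        exact h g hg i⟩
  have hF : Function.Injective F := by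
    rintro ⟨L, hL⟩ ⟨L', hL'⟩ hLL'
    apply Subtype.ext
    apply LinearIsometryEquiv.toLinearEquiv_injective
    apply b.ext'
    intro i
    have := congrArg (fun f => ((f i : S) : EuclideanSpace ℝ (Fin 3))) hLL'
    exact this
  exact Set.finite_coe_iff.1 (Finite.of_injective F hF)

/-! ## Rank three -/

/-- **Rank three**: if the translation vectors of a discontinuous `Γ` contain three linearly
independent vectors, `Γ` has finitely many linear parts. -/
theorem finite_linParts_of_three (hΓ : IsDiscontinuous Γ) {v : Fin 3 → EuclideanSpace ℝ (Fin 3)}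
    (hv : LinearIndependent ℝ v) (hvT : ∀ i, v i ∈ translationVectors Γ) :
    ((fun g : EuclideanSpace ℝ (Fin 3) ≃ᵢ EuclideanSpace ℝ (Fin 3) => g.toRealLinearIsometryEquiv) ''
      (Γ : Set (EuclideanSpace ℝ (Fin 3) ≃ᵢ EuclideanSpace ℝ (Fin 3)))).Finite := by
  let b : Basis (Fin 3) ℝ (EuclideanSpace ℝ (Fin 3)) :=
    basisOfLinearIndependentOfCardEqFinrank hv (by simp)
  set R : ℝ := ∑ j : Fin 3, ‖v j‖ with hR
  refine finite_linParts_of_mapsTo_basis b (finite_translationVectors_inter hΓ R) fun g hg i => ?_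
  have hbi : b i = v i := congrFun (coe_basisOfLinearIndependentOfCardEqFinrank hv (by simp)) i
  rw [hbi]
  refine ⟨lin_apply_mem_translationVectors Γ hg (hvT i), ?_⟩
  rw [mem_closedBall_zero_iff, LinearIsometryEquiv.norm_map, hR]
  exact Finset.single_le_sum (f := fun j => ‖v j‖) (fun j _ => norm_nonneg (v j)) (Finset.mem_univ i)

/-! ## Rank two: the normal direction -/

section RankTwo

variable {v : Fin 2 → EuclideanSpace ℝ (Fin 3)}

/-- The linear parts of `Γ` preserve the span of translation vectors they are given. -/
theorem lin_apply_mem_span (hvT : ∀ i, v i ∈ translationVectors Γ)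
    (hT : translationVectors Γ ⊆ Submodule.span ℝ (Set.range v)) {g : EuclideanSpace ℝ (Fin 3) ≃ᵢ EuclideanSpace ℝ (Fin 3)}
    (hg : g ∈ Γ) {x : EuclideanSpace ℝ (Fin 3)} (hx : x ∈ Submodule.span ℝ (Set.range v)) :
    g.toRealLinearIsometryEquiv x ∈ Submodule.span ℝ (Set.range v) := by
  refine Submodule.span_induction (fun y hy => ?_) (by simp) (fun a b _ _ ha hb => ?_)
    (fun c a _ ha => ?_) hx
  · obtain ⟨i, rfl⟩ := hy
    exact hT (lin_apply_mem_translationVectors Γ hg (hvT i))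
  · rw [map_add]; exact Submodule.add_mem _ ha hb
  · rw [map_smul]; exact Submodule.smul_mem _ c ha

/-- A unit vector orthogonal to the translation plane is mapped to `±` itself by every linear part
of `Γ` (rank two). -/
theorem lin_normal_eq_or (hv : LinearIndependent ℝ v) (hvT : ∀ i, v i ∈ translationVectors Γ)
    (hT : translationVectors Γ ⊆ Submodule.span ℝ (Set.range v)) {n : EuclideanSpace ℝ (Fin 3)}
    (hn : n ∈ (Submodule.span ℝ (Set.range v))ᗮ) (hn1 : ‖n‖ = 1)
    {g : EuclideanSpace ℝ (Fin 3) ≃ᵢ EuclideanSpace ℝ (Fin 3)} (hg : g ∈ Γ) :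
    g.toRealLinearIsometryEquiv n = n ∨ g.toRealLinearIsometryEquiv n = -n := by
  set W : Submodule ℝ (EuclideanSpace ℝ (Fin 3)) := Submodule.span ℝ (Set.range v) with hW
  set L := g.toRealLinearIsometryEquiv with hL
  -- `L n` is orthogonal to `W` (use that `L⁻¹` also preserves `W`)
  have hLn : L n ∈ Wᗮ := by
    rw [Submodule.mem_orthogonal]
    intro w hw
    have hw' : L.symm w ∈ W := by
      have := lin_apply_mem_span hvT hT (Γ.inv_mem hg) hw
      rwa [lin_inv] at this
    have : ⟪w, L n⟫ = ⟪L (L.symm w), L n⟫ := by rw [LinearIsometryEquiv.apply_symm_apply]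
    rw [this, LinearIsometryEquiv.inner_map_map]
    exact (Submodule.mem_orthogonal W n).1 hn _ hw'
  -- `Wᗮ` is the line spanned by `n`
  have hWrank : finrank ℝ W = 2 := by
    rw [hW, finrank_span_eq_card hv]; simp
  have hWorth : finrank ℝ Wᗮ = 1 := by
    have := Submodule.finrank_add_finrank_orthogonal W
    rw [hWrank, finrank_euclideanSpace, Fintype.card_fin] at this
    omega
  have hn0 : n ≠ 0 := by
    intro h; rw [h, norm_zero] at hn1; exact zero_ne_one hn1
  have hspan : Wᗮ = Submodule.span ℝ {n} := by
    refine (Submodule.eq_of_le_of_finrank_eq ?_ ?_).symm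
    · rw [Submodule.span_singleton_le_iff_mem]; exact hn
    · rw [hWorth, finrank_span_singleton hn0]
  rw [hspan, Submodule.mem_span_singleton] at hLn
  obtain ⟨c, hc⟩ := hLn
  have hnorm : ‖c • n‖ = 1 := by rw [hc, LinearIsometryEquiv.norm_map, hn1]
  rw [norm_smul, hn1, mul_one, Real.norm_eq_abs] at hnorm
  rcases abs_eq (zero_le_one) |>.1 hnorm with h1 | h1
  · left; rw [← hc, h1, one_smul]
  · right; rw [← hc, h1, neg_one_smul]

/-- **Rank two**: if the translation vectors of a discontinuous `Γ` contain two independent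
vectors spanning (over `ℝ`) a plane containing all translation vectors, `Γ` has finitely many
linear parts. -/
theorem finite_linParts_of_two (hΓ : IsDiscontinuous Γ) (hv : LinearIndependent ℝ v)
    (hvT : ∀ i, v i ∈ translationVectors Γ) (hT : translationVectors Γ ⊆ Submodule.span ℝ (Set.range v))
    {n : EuclideanSpace ℝ (Fin 3)} (hn : n ∈ (Submodule.span ℝ (Set.range v))ᗮ) (hn1 : ‖n‖ = 1) :
    ((fun g : EuclideanSpace ℝ (Fin 3) ≃ᵢ EuclideanSpace ℝ (Fin 3) => g.toRealLinearIsometryEquiv) ''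
      (Γ : Set (EuclideanSpace ℝ (Fin 3) ≃ᵢ EuclideanSpace ℝ (Fin 3)))).Finite := by
  have hn0 : n ≠ 0 := by
    intro h; rw [h, norm_zero] at hn1; exact zero_ne_one hn1
  -- `n ∉ W`, so `(n, v 0, v 1)` is a basis
  have hnW : n ∉ Submodule.span ℝ (Set.range v) := by
    intro h
    have := (Submodule.mem_orthogonal _ n).1 hn n h
    rw [real_inner_self_eq_norm_sq, hn1] at this
    norm_num at this
  have hind : LinearIndependent ℝ (Fin.cons n v : Fin 3 → EuclideanSpace ℝ (Fin 3)) :=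
    linearIndependent_finCons.2 ⟨hv, hnW⟩
  let b : Basis (Fin 3) ℝ (EuclideanSpace ℝ (Fin 3)) :=
    basisOfLinearIndependentOfCardEqFinrank hind (by simp)
  set R : ℝ := ∑ j : Fin 2, ‖v j‖ with hR
  have hS : ((translationVectors Γ ∩ Metric.closedBall 0 R) ∪ {n, -n}).Finite :=
    (finite_translationVectors_inter hΓ R).union (Set.toFinite _)
  refine finite_linParts_of_mapsTo_basis b hS fun g hg i => ?_
  have hbi : b i = (Fin.cons n v : Fin 3 → EuclideanSpace ℝ (Fin 3)) i :=
    congrFun (coe_basisOfLinearIndependentOfCardEqFinrank hind (by simp)) i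
  rw [hbi]
  refine Fin.cases ?_ (fun j => ?_) i
  · rw [Fin.cons_zero]
    right
    rcases lin_normal_eq_or hv hvT hT hn hn1 hg with h | h <;> simp [h]
  · rw [Fin.cons_succ]
    left
    refine ⟨lin_apply_mem_translationVectors Γ hg (hvT j), ?_⟩
    rw [mem_closedBall_zero_iff, LinearIsometryEquiv.norm_map, hR]
    exact Finset.single_le_sum (f := fun j => ‖v j‖) (fun j _ => norm_nonneg (v j)) (Finset.mem_univ j)

/-! ## Rank two: the invariant plane -/

/-- Powers and linear parts: `L(g^k) = L(g)^k`. -/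
theorem lin_pow (g : EuclideanSpace ℝ (Fin 3) ≃ᵢ EuclideanSpace ℝ (Fin 3)) (k : ℕ) :
    (g ^ k).toRealLinearIsometryEquiv = g.toRealLinearIsometryEquiv ^ k := by
  induction k with
  | zero => rw [pow_zero, pow_zero, lin_one]
  | succ k ih => rw [pow_succ, lin_mul, ih, ← pow_succ]

/-- If `Γ` has finitely many linear parts, some positive power of every `g ∈ Γ` is a translation
of `Γ`. -/
theorem exists_pow_eq_addRight
    (hfin : ((fun g : EuclideanSpace ℝ (Fin 3) ≃ᵢ EuclideanSpace ℝ (Fin 3) => g.toRealLinearIsometryEquiv) ''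
      (Γ : Set (EuclideanSpace ℝ (Fin 3) ≃ᵢ EuclideanSpace ℝ (Fin 3)))).Finite)
    {g : EuclideanSpace ℝ (Fin 3) ≃ᵢ EuclideanSpace ℝ (Fin 3)} (hg : g ∈ Γ) :
    ∃ k : ℕ, 0 < k ∧ g ^ k = IsometryEquiv.addRight ((g ^ k) 0) ∧ (g ^ k) 0 ∈ translationVectors Γ := by
  obtain ⟨a, b, hab, heq⟩ := hfin.exists_lt_map_eq_of_forall_mem
    (f := fun k : ℕ => (g ^ k).toRealLinearIsometryEquiv)
    (fun k => Set.mem_image_of_mem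
      (fun g : EuclideanSpace ℝ (Fin 3) ≃ᵢ EuclideanSpace ℝ (Fin 3) => g.toRealLinearIsometryEquiv)
      (Γ.pow_mem hg k))
  refine ⟨b - a, Nat.sub_pos_of_lt hab, ?_⟩
  have hlin : (g ^ (b - a)).toRealLinearIsometryEquiv = 1 := by
    have h1 : g ^ b = g ^ a * g ^ (b - a) := by rw [← pow_add, Nat.add_sub_cancel' hab.le]
    have h2 : (g ^ b).toRealLinearIsometryEquiv =
        (g ^ a).toRealLinearIsometryEquiv * (g ^ (b - a)).toRealLinearIsometryEquiv := by
      rw [h1, lin_mul]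
    rw [← heq] at h2
    exact (mul_eq_left.1 h2.symm)
  have hga := eq_addRight_of_lin_eq_one hlin
  refine ⟨hga, ?_⟩
  rw [mem_translationVectors_iff, ← hga]
  exact Γ.pow_mem hg _

/-- Heights: if `L(g) n = ε n` with `ε = ±1` then `⟨g x, n⟩ = ε ⟨x, n⟩ + ⟨g 0, n⟩`. -/
theorem inner_apply_normal {g : EuclideanSpace ℝ (Fin 3) ≃ᵢ EuclideanSpace ℝ (Fin 3)} {n : EuclideanSpace ℝ (Fin 3)} {ε : ℝ}
    (hε : ε = 1 ∨ ε = -1) (hgn : g.toRealLinearIsometryEquiv n = ε • n) (x : EuclideanSpace ℝ (Fin 3)) :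
    ⟪g x, n⟫ = ε * ⟪x, n⟫ + ⟪g 0, n⟫ := by
  set L := g.toRealLinearIsometryEquiv with hL
  have hsymm : L.symm n = ε • n := by
    have h1 : L.symm (L n) = n := L.symm_apply_apply n
    rw [hgn, map_smul] at h1
    -- `ε • L.symm n = n` ⇒ `L.symm n = ε • n` as `ε² = 1`
    have hε2 : ε * ε = 1 := by rcases hε with h | h <;> rw [h] <;> norm_num
    calc L.symm n = (ε * ε) • L.symm n := by rw [hε2, one_smul]
      _ = ε • (ε • L.symm n) := by rw [mul_smul]
      _ = ε • n := by rw [h1]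
  rw [apply_eq_lin_add g x, inner_add_left, ← hL]
  congr 1
  calc ⟪L x, n⟫ = ⟪L x, L (L.symm n)⟫ := by rw [LinearIsometryEquiv.apply_symm_apply]
    _ = ⟪x, L.symm n⟫ := by rw [LinearIsometryEquiv.inner_map_map]
    _ = ε * ⟪x, n⟫ := by rw [hsymm, inner_smul_right]

/-- Heights of powers of a height-preserving element: `⟨g^k 0, n⟩ = k ⟨g 0, n⟩` if `L(g) n = n`. -/
theorem inner_pow_apply_zero {g : EuclideanSpace ℝ (Fin 3) ≃ᵢ EuclideanSpace ℝ (Fin 3)} {n : EuclideanSpace ℝ (Fin 3)}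
    (hgn : g.toRealLinearIsometryEquiv n = n) (k : ℕ) :
    ⟪(g ^ k) 0, n⟫ = k * ⟪g 0, n⟫ := by
  induction k with
  | zero => simp
  | succ k ih =>
    rw [pow_succ', IsometryEquiv.coe_mul, Function.comp_apply,
      inner_apply_normal (ε := 1) (Or.inl rfl) (by rw [one_smul]; exact hgn), ih]
    push_cast
    ring

/-- **Rank two, invariant plane.** With `v`, `n` as above (`n` a unit normal of the translation
plane, all translation vectors in that plane) and finitely many linear parts, there is a height
`h₀` such that the plane `{x | ⟨x, n⟩ = h₀}` is invariant under `Γ`. -/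
theorem exists_invariant_height (hvT : ∀ i, v i ∈ translationVectors Γ)
    (hT : translationVectors Γ ⊆ Submodule.span ℝ (Set.range v))
    {n : EuclideanSpace ℝ (Fin 3)} (hn : n ∈ (Submodule.span ℝ (Set.range v))ᗮ)
    (hnor : ∀ g ∈ Γ, g.toRealLinearIsometryEquiv n = n ∨ g.toRealLinearIsometryEquiv n = -n)
    (hfin : ((fun g : EuclideanSpace ℝ (Fin 3) ≃ᵢ EuclideanSpace ℝ (Fin 3) => g.toRealLinearIsometryEquiv) ''
      (Γ : Set (EuclideanSpace ℝ (Fin 3) ≃ᵢ EuclideanSpace ℝ (Fin 3)))).Finite) :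
    ∃ h₀ : ℝ, ∀ g ∈ Γ, ∀ x : EuclideanSpace ℝ (Fin 3), ⟪x, n⟫ = h₀ → ⟪g x, n⟫ = h₀ := by
  have _ := hvT
  -- (1) height-preserving elements have zero offset
  have hzero : ∀ g ∈ Γ, g.toRealLinearIsometryEquiv n = n → ⟪g 0, n⟫ = 0 := by
    intro g hg hgn
    obtain ⟨k, hk, hga, hgT⟩ := exists_pow_eq_addRight hfin hg
    have hw : ⟪(g ^ k) 0, n⟫ = 0 := by
      have hmem := hT hgT
      exact (Submodule.mem_orthogonal _ n).1 hn _ hmem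
    rw [inner_pow_apply_zero hgn k] at hw
    have hk' : (k : ℝ) ≠ 0 := by exact_mod_cast hk.ne'
    exact (mul_eq_zero.1 hw).resolve_left hk'
  -- (2) height-reversing elements share their offset
  have hsame : ∀ g ∈ Γ, ∀ h ∈ Γ, g.toRealLinearIsometryEquiv n = -n →
      h.toRealLinearIsometryEquiv n = -n → ⟪g 0, n⟫ = ⟪h 0, n⟫ := by
    intro g hg h hh hgn hhn
    have hghn : (g * h).toRealLinearIsometryEquiv n = n := by
      rw [lin_mul, LinearIsometryEquiv.coe_mul, Function.comp_apply, hhn, map_neg, hgn, neg_neg]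
    have h0 := hzero (g * h) (Γ.mul_mem hg hh) hghn
    rw [IsometryEquiv.coe_mul, Function.comp_apply,
      inner_apply_normal (ε := -1) (Or.inr rfl) (by rw [neg_one_smul]; exact hgn)] at h0
    linarith
  classical
  by_cases hex : ∃ g ∈ Γ, g.toRealLinearIsometryEquiv n = -n
  · obtain ⟨g₁, hg₁, hg₁n⟩ := hex
    refine ⟨⟪g₁ 0, n⟫ / 2, fun g hg x hx => ?_⟩
    rcases hnor g hg with hgn | hgn
    · rw [inner_apply_normal (ε := 1) (Or.inl rfl) (by rw [one_smul]; exact hgn), hx,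
        hzero g hg hgn]
      ring
    · rw [inner_apply_normal (ε := -1) (Or.inr rfl) (by rw [neg_one_smul]; exact hgn), hx,
        hsame g hg g₁ hg₁ hgn hg₁n]
      ring
  · push Not at hex
    refine ⟨0, fun g hg x hx => ?_⟩
    have hgn : g.toRealLinearIsometryEquiv n = n := (hnor g hg).resolve_right (hex g hg)
    rw [inner_apply_normal (ε := 1) (Or.inl rfl) (by rw [one_smul]; exact hgn), hx, hzero g hg hgn]
    ring

/-- The plane `{x | ⟨x, n⟩ = h₀}` (`‖n‖ = 1`) as an affine subspace: `h₀ • n + (ℝ ∙ n)ᗮ`; membership. -/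
theorem mem_plane_iff {n : EuclideanSpace ℝ (Fin 3)} (hn1 : ‖n‖ = 1) (h₀ : ℝ) (x : EuclideanSpace ℝ (Fin 3)) :
    x ∈ (AffineSubspace.mk' (h₀ • n) (Submodule.span ℝ {n})ᗮ : Set (EuclideanSpace ℝ (Fin 3))) ↔ ⟪x, n⟫ = h₀ := by
  rw [SetLike.mem_coe, AffineSubspace.mem_mk', vsub_eq_sub,
    Submodule.mem_orthogonal_singleton_iff_inner_left, inner_sub_left, inner_smul_left,
    real_inner_self_eq_norm_sq, hn1]
  simp [sub_eq_zero]

/-- **Rank two, invariant plane** packaged as an affine subspace: under the hypotheses of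
`exists_invariant_height` (and `‖n‖ = 1`) there is a nonempty `Γ`-invariant affine subspace of
dimension `2`. -/
theorem exists_invariant_plane (hvT : ∀ i, v i ∈ translationVectors Γ)
    (hT : translationVectors Γ ⊆ Submodule.span ℝ (Set.range v))
    {n : EuclideanSpace ℝ (Fin 3)} (hn : n ∈ (Submodule.span ℝ (Set.range v))ᗮ) (hn1 : ‖n‖ = 1)
    (hnor : ∀ g ∈ Γ, g.toRealLinearIsometryEquiv n = n ∨ g.toRealLinearIsometryEquiv n = -n)
    (hfin : ((fun g : EuclideanSpace ℝ (Fin 3) ≃ᵢ EuclideanSpace ℝ (Fin 3) => g.toRealLinearIsometryEquiv) ''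
      (Γ : Set (EuclideanSpace ℝ (Fin 3) ≃ᵢ EuclideanSpace ℝ (Fin 3)))).Finite) :
    ∃ V : AffineSubspace ℝ (EuclideanSpace ℝ (Fin 3)),
      (V : Set (EuclideanSpace ℝ (Fin 3))).Nonempty ∧ Module.finrank ℝ V.direction ≤ 2 ∧
      ∀ g ∈ Γ, g '' (V : Set (EuclideanSpace ℝ (Fin 3))) = V := by
  obtain ⟨h₀, hh₀⟩ := exists_invariant_height hvT hT hn hnor hfin
  have hn0 : n ≠ 0 := by
    intro h; rw [h, norm_zero] at hn1; exact zero_ne_one hn1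
  refine ⟨AffineSubspace.mk' (h₀ • n) (Submodule.span ℝ {n})ᗮ, ⟨h₀ • n, AffineSubspace.self_mem_mk' _ _⟩, ?_, ?_⟩
  · rw [AffineSubspace.direction_mk']
    have := Submodule.finrank_add_finrank_orthogonal (Submodule.span ℝ ({n} : Set (EuclideanSpace ℝ (Fin 3))))
    rw [finrank_span_singleton hn0, finrank_euclideanSpace, Fintype.card_fin] at this
    omega
  · intro g hg
    -- both `g` and `g⁻¹` map the plane into itself
    have hinto : ∀ g ∈ Γ, g '' (AffineSubspace.mk' (h₀ • n) (Submodule.span ℝ {n})ᗮ : Set (EuclideanSpace ℝ (Fin 3)))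
        ⊆ AffineSubspace.mk' (h₀ • n) (Submodule.span ℝ {n})ᗮ := by
      rintro g hg _ ⟨x, hx, rfl⟩
      rw [mem_plane_iff hn1] at hx ⊢
      exact hh₀ g hg x hx
    refine Set.Subset.antisymm (hinto g hg) fun x hx => ?_
    refine ⟨g⁻¹ x, hinto g⁻¹ (Γ.inv_mem hg) ⟨x, hx, rfl⟩, ?_⟩
    change g (g.symm x) = x
    exact g.apply_symm_apply x

end RankTwo

/-- Anchor (registered sub-goal of `stub_groupStructure`): **rank three ⇒ finitely many linear
parts**, in closed form. -/
theorem groupStructure_rankThree_finite_linParts : ∀ Γ : Subgroup (EuclideanSpace ℝ (Fin 3) ≃ᵢ EuclideanSpace ℝ (Fin 3)), Literature.Geometry.DiscreteGeometry.Crystallographic.IsDiscontinuous Γ → ∀ v : Fin 3 → EuclideanSpace ℝ (Fin 3), LinearIndependent ℝ v → (∀ i, v i ∈ Literature.Geometry.DiscreteGeometry.Crystallographic.translationVectors Γ) → ((fun g : EuclideanSpace ℝ (Fin 3) ≃ᵢ EuclideanSpace ℝ (Fin 3) => g.toRealLinearIsometryEquiv) '' (Γ : Set (EuclideanSpace ℝ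 (Fin 3) ≃ᵢ EuclideanSpace ℝ (Fin 3)))).Finite := by
  intro Γ hΓ v hv hvT
  exact finite_linParts_of_three hΓ hv hvT

end Summit.AtomisticToContinuum.Crystallization.Theorems.IsometryAtomsMinimisingLawsCohesive.GroupStructure

end
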